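import Summits.RiemannHypothesis.RiemannHypothesis.Theorems.MotivicDoorAWSForcingReduction
import Summits.RiemannHypothesis.RiemannHypothesis.Theorems.WeilGroundStateGroundStateSimpleEvenStubPairPrelim

/-!
# AWS sprint (e), TEST-CLASS-DOWN: window continuity of the prime-side data; the sprint theorem

HONEST LABEL.  One-way implication from a strengthened, prime-side-only axiom system; the existence
of an `ArithmeticWeilSurface` is NOT claimed and is the located gap; the converse (RH ⇒ existence) is
out of scope and, for this axiom system, tautological rather than informative (HOME
`AXIOM-CONTENT.md` §2; `riemannHypothesis_iff_exists_tautologicalCarrier` in `AWS/Tautological`;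
REFEREE-1 B36/B39): `Nonempty ArithmeticWeilSurface` is a restatement of RH in structure clothing,
NOT evidence for RH.  Framing: lottery ticket at the motivic door; RH probability negligible;
consolation prizes are real: a new semi-local Weil-positivity theorem, or a located gap in the
Connes–Consani programme, plus the ff-door theorem.

This file discharges the single analytic input `CcDataContinuous` (`∀ R > 0, CcDataContinuousOn R`,
`Theorems/MotivicDoorAWSForcingReduction`) to which the sprint theorem was reduced, and assembles
`riemannHypothesis_of_arithmeticWeilSurface : Nonempty ArithmeticWeilSurface → RiemannHypothesis`.
ESTIMATE: for real Weil tests `u, v` supported in `[-R, R]` with `|u − v| ≤ ε`, `|u' − v'| ≤ ε`, the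
prime-side numbers `𝔰(f,f)`, `∫ f d*u`, `∫ f du` (`f = toMul u`) move by `O_u(ε)`: the masses are
`ĝ(0)`, `ĝ(1)` (`weilMellin_zero_eq_massDstar`, `…_one_eq_massDu`) with `|ĝ(s)| ≤ 2R e^{R/2} sup|g|`
on the window; Weil's functional by polarisation `Q(U) − Q(V) = Q(U−V) + W(V ⋆ (U−V)~) + W((U−V) ⋆ Ṽ)`
(`weilQuadratic_add`) and the tree's PROVED pair continuity on `L² × H¹` of the window
`‖W(f ⋆ h̃)‖ ≤ C ‖f‖₂ (‖h‖₂ + ‖h'‖₂)` (`Theorems.stub_pairContinuity`), `‖·‖₂ ≤ √(2R) sup|·|`; and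
`2 𝔰(f,f) = 2 (∫ f d*u)(∫ f du) − Re Q(u)` (`two_mul_ccPairing_sub_two_mul_masses_eq`).  No zeros of
`ζ`, no RH-derived input; `RiemannHypothesis` is Mathlib's, reached through `weil_criterion_holds`.
-/

noncomputable section

open Complex Set MeasureTheory Filter Literature.NumberTheory.LFunctions
open Literature.NumberTheory.ConnesConsani2019
open Summit.RiemannHypothesis.RiemannHypothesis.Theorems.MotivicDoor.ConnesConsani

namespace Summit.RiemannHypothesis.RiemannHypothesis.Theorems.MotivicDoor.AWS

-- the mandated namespace `Summit.RiemannHypothesis.RiemannHypothesis.…` (single-conjunct summit)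
-- repeats a component
set_option linter.dupNamespace false

/-! ## Window estimates: `L²` and Mellin bounds from sup bounds on `[-R, R]` -/

/-- On a window: if `f` vanishes off `[-R, R]` and `‖f‖ ≤ M`, then `∫ ‖f‖² ≤ 2R M²`. -/
theorem integral_norm_sq_le_window {f : ℝ → ℂ} {R M : ℝ} (hR : 0 ≤ R)
    (hsupp : Function.support f ⊆ Icc (-R) R) (hbound : ∀ t, ‖f t‖ ≤ M) :
    ∫ t, ‖f t‖ ^ 2 ≤ 2 * R * M ^ 2 := by
  have hzero : ∀ t ∉ Icc (-R) R, ‖f t‖ ^ 2 = 0 := fun t ht ↦ by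
    have hft : f t = 0 := Function.notMem_support.mp fun h ↦ ht (hsupp h)
    simp [hft]
  rw [← setIntegral_eq_integral_of_forall_compl_eq_zero hzero]
  have h1 : ‖∫ t in Icc (-R) R, ‖f t‖ ^ 2‖ ≤ M ^ 2 * volume.real (Icc (-R) R) :=
    norm_setIntegral_le_of_norm_le_const measure_Icc_lt_top fun t _ ↦ by
      rw [Real.norm_of_nonneg (by positivity)]
      exact pow_le_pow_left₀ (norm_nonneg _) (hbound t) 2
  rw [Real.volume_real_Icc_of_le (by linarith)] at h1
  calc ∫ t in Icc (-R) R, ‖f t‖ ^ 2 ≤ ‖∫ t in Icc (-R) R, ‖f t‖ ^ 2‖ := Real.le_norm_self _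
    _ ≤ M ^ 2 * (R - -R) := h1
    _ = 2 * R * M ^ 2 := by ring

/-- On a window: if `f` vanishes off `[-R, R]` and `‖f‖ ≤ M` (`M ≥ 0`), then
`‖f‖₂ = √(∫ ‖f‖²) ≤ √(2R) M`. -/
theorem sqrt_integral_norm_sq_le_window {f : ℝ → ℂ} {R M : ℝ} (hR : 0 ≤ R) (hM : 0 ≤ M)
    (hsupp : Function.support f ⊆ Icc (-R) R) (hbound : ∀ t, ‖f t‖ ≤ M) :
    √(∫ t, ‖f t‖ ^ 2) ≤ √(2 * R) * M := by
  calc √(∫ t, ‖f t‖ ^ 2) ≤ √(2 * R * M ^ 2) :=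
        Real.sqrt_le_sqrt (integral_norm_sq_le_window hR hsupp hbound)
    _ = √(2 * R) * M := by
        rw [Real.sqrt_mul (by positivity), Real.sqrt_sq hM]

/-- On a window: if `g` vanishes off `[-R, R]` and `‖g‖ ≤ M`, then in the closed critical strip
`‖ĝ(s)‖ ≤ 2R · M e^{R/2}` (`ĝ = weilMellin g`, `|e^{(s−½)t}| ≤ e^{|t|/2} ≤ e^{R/2}` on the window). -/
theorem norm_weilMellin_le_window {g : ℝ → ℂ} {R M : ℝ} (hR : 0 ≤ R)
    (hsupp : Function.support g ⊆ Icc (-R) R) (hbound : ∀ t, ‖g t‖ ≤ M)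
    {s : ℂ} (hs0 : 0 ≤ s.re) (hs1 : s.re ≤ 1) :
    ‖weilMellin g s‖ ≤ 2 * R * (M * Real.exp (R / 2)) := by
  have hM : 0 ≤ M := (norm_nonneg _).trans (hbound 0)
  have hzero : ∀ t ∉ Icc (-R) R, g t * cexp ((s - 1 / 2) * t) = 0 := fun t ht ↦ by
    have hgt : g t = 0 := Function.notMem_support.mp fun h ↦ ht (hsupp h)
    simp [hgt]
  unfold weilMellin
  rw [← setIntegral_eq_integral_of_forall_compl_eq_zero hzero]
  have h1 : ‖∫ t in Icc (-R) R, g t * cexp ((s - 1 / 2) * t)‖ ≤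
      M * Real.exp (R / 2) * volume.real (Icc (-R) R) :=
    norm_setIntegral_le_of_norm_le_const measure_Icc_lt_top fun t ht ↦ by
      rw [norm_mul, Complex.norm_exp]
      refine mul_le_mul (hbound t) (Real.exp_le_exp.2 ?_) (Real.exp_nonneg _) hM
      have hre : ((s - 1 / 2) * (t : ℂ)).re = (s.re - 1 / 2) * t := by
        simp [sub_re, mul_re]
      rw [hre]
      have h1 : |s.re - 1 / 2| ≤ 1 / 2 := abs_le.2 ⟨by linarith, by linarith⟩
      have ht' : |t| ≤ R := abs_le.2 ⟨ht.1, ht.2⟩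
      calc (s.re - 1 / 2) * t ≤ |(s.re - 1 / 2) * t| := le_abs_self _
        _ = |s.re - 1 / 2| * |t| := abs_mul _ _
        _ ≤ 1 / 2 * R := mul_le_mul h1 ht' (abs_nonneg _) (by norm_num)
        _ = R / 2 := by ring
  rw [Real.volume_real_Icc_of_le (by linarith)] at h1
  calc ‖∫ t in Icc (-R) R, g t * cexp ((s - 1 / 2) * t)‖ ≤ M * Real.exp (R / 2) * (R - -R) := h1
    _ = 2 * R * (M * Real.exp (R / 2)) := by ring

/-! ## Real test functions as complex ones -/

section RealTests

variable {u v : ℝ → ℝ} {R : ℝ}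

/-- The topological support of `t ↦ (u t : ℂ)` is that of `u`. -/
theorem tsupport_ofReal_comp (u : ℝ → ℝ) : tsupport (fun t ↦ (u t : ℂ)) = tsupport u := by
  have : Function.support (fun t ↦ (u t : ℂ)) = Function.support u := by ext t; simp
  simp only [tsupport, this]

/-- The derivative of `t ↦ (u t : ℂ)` is `t ↦ (u' t : ℂ)` for a real Weil test function `u`
(`u = Re ∘ (u : ℂ)` is differentiable; `HasDerivAt.ofReal_comp`). -/
theorem deriv_ofReal_comp_of_isWeilTest (hu : IsWeilTest fun t ↦ (u t : ℂ)) :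
    deriv (fun t ↦ (u t : ℂ)) = fun t ↦ ((deriv u t : ℝ) : ℂ) := by
  have hd : Differentiable ℝ fun t ↦ (u t : ℂ) := hu.1.differentiable (by simp)
  have hre : Differentiable ℝ u := by
    have : u = fun t ↦ ((u t : ℂ)).re := funext fun t ↦ by simp
    rw [this]
    exact Complex.reCLM.differentiable.comp hd
  funext t
  exact ((hre t).hasDerivAt.ofReal_comp).deriv

/-- **Masses, TEST-CLASS-DOWN.**  If `u, v` are real Weil test functions supported in `[-R, R]`
with `|u − v| ≤ ε` everywhere, then `|∫ f_u d*u − ∫ f_v d*u|, |∫ f_u du − ∫ f_v du| ≤ 2R e^{R/2} ε`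
(the masses are `ĝ(0)`, `ĝ(1)`; `norm_weilMellin_le_window` for `g = u − v`). -/
theorem abs_masses_sub_le (hR : 0 ≤ R) (hu : IsWeilTest fun t ↦ (u t : ℂ))
    (hv : IsWeilTest fun t ↦ (v t : ℂ)) (hsu : tsupport u ⊆ Icc (-R) R)
    (hsv : tsupport v ⊆ Icc (-R) R) {ε : ℝ} (hε : ∀ t, |u t - v t| ≤ ε) :
    |massDstar (toMul u) - massDstar (toMul v)| ≤ 2 * R * (ε * Real.exp (R / 2)) ∧
      |massDu (toMul u) - massDu (toMul v)| ≤ 2 * R * (ε * Real.exp (R / 2)) := by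
  have hsub : ((fun t ↦ (u t : ℂ)) - fun t ↦ (v t : ℂ)) = fun t ↦ ((u t - v t : ℝ) : ℂ) := by
    funext t; simp
  have hsupp : Function.support (fun t ↦ ((u t - v t : ℝ) : ℂ)) ⊆ Icc (-R) R := by
    intro t ht
    rw [Function.mem_support, ne_eq, Complex.ofReal_eq_zero, sub_eq_zero] at ht
    by_contra hnot
    have hu0 : u t = 0 := image_eq_zero_of_notMem_tsupport fun h ↦ hnot (hsu h)
    have hv0 : v t = 0 := image_eq_zero_of_notMem_tsupport fun h ↦ hnot (hsv h)
    exact ht (by rw [hu0, hv0])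
  have hbound : ∀ t, ‖((u t - v t : ℝ) : ℂ)‖ ≤ ε := fun t ↦ by
    rw [Complex.norm_real, Real.norm_eq_abs]; exact hε t
  have hM := weilMellin_sub hu.1.continuous hu.2 hv.1.continuous hv.2
  constructor
  · rw [← Real.norm_eq_abs, ← Complex.norm_real, Complex.ofReal_sub, ← weilMellin_zero_eq_massDstar,
      ← weilMellin_zero_eq_massDstar, ← hM, hsub]
    exact norm_weilMellin_le_window hR hsupp hbound (by simp) (by simp)
  · rw [← Real.norm_eq_abs, ← Complex.norm_real, Complex.ofReal_sub, ← weilMellin_one_eq_massDu,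
      ← weilMellin_one_eq_massDu, ← hM, hsub]
    exact norm_weilMellin_le_window hR hsupp hbound (by simp) (by simp)

end RealTests

/-! ## Continuity of Weil's quadratic functional in the `C¹`-window topology -/

section Quadratic

variable {R : ℝ} {U V : ℝ → ℂ}

/-- Polarisation over a difference: `Q(U) − Q(V) = Q(U − V) + (W(V ⋆ (U−V)~) + W((U−V) ⋆ Ṽ))`. -/
theorem weilQuadratic_sub_eq (hU : IsWeilTest U) (hV : IsWeilTest V) :
    weilQuadratic U - weilQuadratic V =
      weilQuadratic (U - V) + (weilFunctional (weilConv V (weilReflect (U - V))) +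
        weilFunctional (weilConv (U - V) (weilReflect V))) := by
  have h := weilQuadratic_add hV (hU.sub hV)
  rw [show V + (U - V) = U by abel] at h
  rw [h]; ring

/-- **Weil's quadratic functional, TEST-CLASS-DOWN.**  Let `C` be a pair-continuity constant of
the Weil form on the window `[-R, R]` (`‖W(f ⋆ h̃)‖ ≤ C ‖f‖₂ (‖h‖₂ + ‖h'‖₂)`,
`Theorems.stub_pairContinuity`).  If `U, V` are test functions supported in the window with
`‖U − V‖ ≤ ε ≤ 1`, `‖U' − V'‖ ≤ ε`, `‖U‖ ≤ S`, `‖U'‖ ≤ S'` everywhere, then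
`‖Q(U) − Q(V)‖ ≤ ε · C · 2R · (6 + 3S + S')`. -/
theorem norm_weilQuadratic_sub_le (hR : 0 < R) {C : ℝ} (hC0 : 0 ≤ C)
    (hC : ∀ f h : ℝ → ℂ, IsWeilTest f → tsupport f ⊆ Icc (-R) R →
      IsWeilTest h → tsupport h ⊆ Icc (-R) R →
        ‖weilFunctional (weilConv f (weilReflect h))‖ ≤
          C * √(∫ t, ‖f t‖ ^ 2) * (√(∫ t, ‖h t‖ ^ 2) + √(∫ t, ‖deriv h t‖ ^ 2)))
    (hU : IsWeilTest U) (hV : IsWeilTest V) (hsU : tsupport U ⊆ Icc (-R) R)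
    (hsV : tsupport V ⊆ Icc (-R) R) {ε S S' : ℝ} (hε0 : 0 ≤ ε) (hε1 : ε ≤ 1)
    (hS : ∀ t, ‖U t‖ ≤ S) (hS' : ∀ t, ‖deriv U t‖ ≤ S')
    (hUV : ∀ t, ‖U t - V t‖ ≤ ε) (hUV' : ∀ t, ‖deriv U t - deriv V t‖ ≤ ε) :
    ‖weilQuadratic U - weilQuadratic V‖ ≤ ε * (C * (2 * R) * (6 + 3 * S + S')) := by
  have hR0 : 0 ≤ R := hR.le
  have hS0 : 0 ≤ S := (norm_nonneg _).trans (hS 0)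
  have hS'0 : 0 ≤ S' := (norm_nonneg _).trans (hS' 0)
  set A : ℝ := √(2 * R) with hA
  have hA0 : 0 ≤ A := Real.sqrt_nonneg _
  have hA2 : A * A = 2 * R := Real.mul_self_sqrt (by positivity)
  -- the difference `W := U - V` and its window data
  have hW : IsWeilTest (U - V) := hU.sub hV
  have hsW : tsupport (U - V) ⊆ Icc (-R) R := GroundStateSimpleEven.tsupport_sub_subset_Icc hsU hsV
  have hdU : Differentiable ℝ U := hU.1.differentiable (by simp)
  have hdV : Differentiable ℝ V := hV.1.differentiable (by simp)
  have hderivW : deriv (U - V) = fun t ↦ deriv U t - deriv V t := by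
    funext t
    exact ((hdU t).hasDerivAt.sub (hdV t).hasDerivAt).deriv
  -- pointwise bounds
  have hWpt : ∀ t, ‖(U - V) t‖ ≤ ε := fun t ↦ by simpa using hUV t
  have hW'pt : ∀ t, ‖deriv (U - V) t‖ ≤ ε := fun t ↦ by rw [hderivW]; exact hUV' t
  have hVpt : ∀ t, ‖V t‖ ≤ S + 1 := fun t ↦ by
    linarith [norm_le_insert (U t) (V t), hS t, hUV t]
  have hV'pt : ∀ t, ‖deriv V t‖ ≤ S' + 1 := fun t ↦ by
    linarith [norm_le_insert (deriv U t) (deriv V t), hS' t, hUV' t]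
  -- supports (as `Function.support`) inside the window
  have hsuppW : Function.support (U - V) ⊆ Icc (-R) R := (subset_tsupport _).trans hsW
  have hsuppW' : Function.support (deriv (U - V)) ⊆ Icc (-R) R := support_deriv_subset.trans hsW
  have hsuppV : Function.support V ⊆ Icc (-R) R := (subset_tsupport _).trans hsV
  have hsuppV' : Function.support (deriv V) ⊆ Icc (-R) R := support_deriv_subset.trans hsV
  -- `L²` bounds
  have hW2 : √(∫ t, ‖(U - V) t‖ ^ 2) ≤ A * ε := sqrt_integral_norm_sq_le_window hR0 hε0 hsuppW hWpt
  have hW'2 : √(∫ t, ‖deriv (U - V) t‖ ^ 2) ≤ A * ε :=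
    sqrt_integral_norm_sq_le_window hR0 hε0 hsuppW' hW'pt
  have hV2 : √(∫ t, ‖V t‖ ^ 2) ≤ A * (S + 1) :=
    sqrt_integral_norm_sq_le_window hR0 (by linarith) hsuppV hVpt
  have hV'2 : √(∫ t, ‖deriv V t‖ ^ 2) ≤ A * (S' + 1) :=
    sqrt_integral_norm_sq_le_window hR0 (by linarith) hsuppV' hV'pt
  -- the three terms
  have h1 : ‖weilQuadratic (U - V)‖ ≤ C * (A * ε) * (A * ε + A * ε) := by
    have h := hC (U - V) (U - V) hW hsW hW hsW
    unfold weilQuadratic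
    refine h.trans ?_
    gcongr
  have h2 : ‖weilFunctional (weilConv V (weilReflect (U - V)))‖ ≤
      C * (A * (S + 1)) * (A * ε + A * ε) := by
    refine (hC V (U - V) hV hsV hW hsW).trans ?_
    gcongr
  have h3 : ‖weilFunctional (weilConv (U - V) (weilReflect V))‖ ≤
      C * (A * ε) * (A * (S + 1) + A * (S' + 1)) := by
    refine (hC (U - V) V hW hsW hV hsV).trans ?_
    gcongr
  rw [weilQuadratic_sub_eq hU hV]
  calc ‖weilQuadratic (U - V) + (weilFunctional (weilConv V (weilReflect (U - V))) +
        weilFunctional (weilConv (U - V) (weilReflect V)))‖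
      ≤ ‖weilQuadratic (U - V)‖ + (‖weilFunctional (weilConv V (weilReflect (U - V)))‖ +
        ‖weilFunctional (weilConv (U - V) (weilReflect V))‖) :=
        (norm_add_le _ _).trans (add_le_add le_rfl (norm_add_le _ _))
    _ ≤ C * (A * ε) * (A * ε + A * ε) + (C * (A * (S + 1)) * (A * ε + A * ε) +
        C * (A * ε) * (A * (S + 1) + A * (S' + 1))) := add_le_add h1 (add_le_add h2 h3)
    _ = ε * (C * (A * A) * (2 * ε + 3 * (S + 1) + (S' + 1))) := by ring
    _ ≤ ε * (C * (A * A) * (2 * 1 + 3 * (S + 1) + (S' + 1))) := by gcongr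
    _ = ε * (C * (2 * R) * (6 + 3 * S + S')) := by rw [hA2]; ring

end Quadratic

/-! ## The TEST-CLASS-DOWN node and the sprint theorem -/

/-- **`CcDataContinuousOn R` for `R > 0`** (TEST-CLASS-DOWN): the prime-side data
`𝔰(f,f)`, `∫ f d*u`, `∫ f du` of real Weil test functions supported in `[-R, R]` are continuous for
`C¹`-uniform convergence on the window. -/
theorem ccDataContinuousOn_of_pos {R : ℝ} (hR : 0 < R) : CcDataContinuousOn R := by
  intro u hu hsu δ hδ
  obtain ⟨C, hC0, hC⟩ := Theorems.stub_pairContinuity R hR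
  set U : ℝ → ℂ := fun t ↦ (u t : ℂ) with hUdef
  obtain ⟨S, hS⟩ := hu.1.continuous.bounded_above_of_compact_support hu.2
  obtain ⟨S', hS'⟩ := hu.deriv.1.continuous.bounded_above_of_compact_support hu.deriv.2
  have hS0 : 0 ≤ S := (norm_nonneg _).trans (hS 0)
  have hS'0 : 0 ≤ S' := (norm_nonneg _).trans (hS' 0)
  -- the constants
  set Km : ℝ := 2 * R * Real.exp (R / 2) with hKm
  set KQ : ℝ := C * (2 * R) * (6 + 3 * S + S') with hKQ
  set Ds : ℝ := |massDstar (toMul u)| with hDs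
  set Du : ℝ := |massDu (toMul u)| with hDu
  set K : ℝ := Km * (Du + Ds + Km) + KQ + Km + 1 with hK
  have hKm0 : 0 ≤ Km := by positivity
  have hKQ0 : 0 ≤ KQ := by positivity
  have hK0 : 0 < K := by positivity
  refine ⟨min 1 (δ / K), lt_min one_pos (div_pos hδ hK0), ?_⟩
  intro v hv hsv hval hder
  set ε : ℝ := min 1 (δ / K) with hεdef
  have hε0 : 0 ≤ ε := (lt_min one_pos (div_pos hδ hK0)).le
  have hε1 : ε ≤ 1 := min_le_left _ _
  have hεK : ε * K ≤ δ := by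
    have := min_le_right 1 (δ / K)
    calc ε * K ≤ δ / K * K := by gcongr
      _ = δ := by field_simp
  set V : ℝ → ℂ := fun t ↦ (v t : ℂ) with hVdef
  -- masses
  obtain ⟨hm1, hm2⟩ := abs_masses_sub_le hR.le hu hv hsu hsv hval
  have hm1' : |massDstar (toMul u) - massDstar (toMul v)| ≤ ε * Km := by
    rw [hKm]; convert hm1 using 1; ring
  have hm2' : |massDu (toMul u) - massDu (toMul v)| ≤ ε * Km := by
    rw [hKm]; convert hm2 using 1; ring
  -- Weil's quadratic functional
  have hsU : tsupport U ⊆ Icc (-R) R := by rw [hUdef, tsupport_ofReal_comp]; exact hsu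
  have hsV : tsupport V ⊆ Icc (-R) R := by rw [hVdef, tsupport_ofReal_comp]; exact hsv
  have hUV : ∀ t, ‖U t - V t‖ ≤ ε := fun t ↦ by
    rw [hUdef, hVdef]; dsimp only
    rw [← Complex.ofReal_sub, Complex.norm_real, Real.norm_eq_abs]; exact hval t
  have hUV' : ∀ t, ‖deriv U t - deriv V t‖ ≤ ε := fun t ↦ by
    rw [hUdef, hVdef, deriv_ofReal_comp_of_isWeilTest hu, deriv_ofReal_comp_of_isWeilTest hv]
    dsimp only
    rw [← Complex.ofReal_sub, Complex.norm_real, Real.norm_eq_abs]; exact hder t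
  have hQ : ‖weilQuadratic U - weilQuadratic V‖ ≤ ε * KQ :=
    norm_weilQuadratic_sub_le hR hC0 hC hu hv hsU hsV hε0 hε1 hS hS' hUV hUV'
  have hQre : |(weilQuadratic U).re - (weilQuadratic V).re| ≤ ε * KQ := by
    rw [← Complex.sub_re]
    exact (Complex.abs_re_le_norm _).trans hQ
  -- the product of the masses
  have hprod : |massDstar (toMul u) * massDu (toMul u) - massDstar (toMul v) * massDu (toMul v)| ≤
      ε * (Km * (Du + Ds + Km)) := by
    have h1 : ∀ a b a' b' : ℝ, |a * b - a' * b'| ≤ |a - a'| * |b| + |a'| * |b - b'| :=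
      fun a b a' b' ↦ by
        rw [show a * b - a' * b' = (a - a') * b + a' * (b - b') by ring]
        exact (abs_add_le _ _).trans (by rw [abs_mul, abs_mul])
    have h2 : |massDstar (toMul v)| ≤ Ds + ε * Km := by
      have := abs_sub_abs_le_abs_sub (massDstar (toMul v)) (massDstar (toMul u))
      rw [abs_sub_comm] at this; linarith
    calc |massDstar (toMul u) * massDu (toMul u) - massDstar (toMul v) * massDu (toMul v)|
        ≤ |massDstar (toMul u) - massDstar (toMul v)| * |massDu (toMul u)| +
          |massDstar (toMul v)| * |massDu (toMul u) - massDu (toMul v)| := h1 _ _ _ _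
      _ ≤ ε * Km * Du + (Ds + ε * Km) * (ε * Km) := by
          gcongr
      _ = ε * (Km * (Du + Ds + ε * Km)) := by ring
      _ ≤ ε * (Km * (Du + Ds + 1 * Km)) := by gcongr
      _ = ε * (Km * (Du + Ds + Km)) := by ring
  -- the pairing `𝔰`
  have hsu_id := two_mul_ccPairing_sub_two_mul_masses_eq hu
  have hsv_id := two_mul_ccPairing_sub_two_mul_masses_eq hv
  have hpair : |ccPairing (toMul u) (toMul u) - ccPairing (toMul v) (toMul v)| ≤
      ε * (Km * (Du + Ds + Km)) + ε * KQ / 2 := by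
    have e : ccPairing (toMul u) (toMul u) - ccPairing (toMul v) (toMul v) =
        (massDstar (toMul u) * massDu (toMul u) - massDstar (toMul v) * massDu (toMul v)) -
          ((weilQuadratic U).re - (weilQuadratic V).re) / 2 := by
      rw [hUdef, hVdef]; linarith
    rw [e]
    calc |massDstar (toMul u) * massDu (toMul u) - massDstar (toMul v) * massDu (toMul v) -
          ((weilQuadratic U).re - (weilQuadratic V).re) / 2|
        ≤ |massDstar (toMul u) * massDu (toMul u) - massDstar (toMul v) * massDu (toMul v)| +
          |((weilQuadratic U).re - (weilQuadratic V).re) / 2| := abs_sub _ _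
      _ ≤ ε * (Km * (Du + Ds + Km)) + ε * KQ / 2 := by
          rw [abs_div, abs_two]
          gcongr
  have hKmK : ε * Km ≤ δ := by
    refine le_trans ?_ hεK
    rw [hK]; gcongr; nlinarith [hKm0, hKQ0, abs_nonneg (massDstar (toMul u)),
      abs_nonneg (massDu (toMul u))]
  refine ⟨?_, hm1'.trans hKmK, hm2'.trans hKmK⟩
  calc |ccPairing (toMul u) (toMul u) - ccPairing (toMul v) (toMul v)|
      ≤ ε * (Km * (Du + Ds + Km)) + ε * KQ / 2 := hpair
    _ ≤ ε * K := by rw [hK]; nlinarith [hε0, hKQ0, hKm0]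
    _ ≤ δ := hεK

/-- A real test function whose topological support lies in `[-R, R]` with `R ≤ 0` vanishes (its
support is open and contained in `interior [-R, R] = ∅`). -/
theorem eq_zero_of_tsupport_subset_Icc_of_nonpos {u : ℝ → ℝ} (hu : IsWeilTest fun t ↦ (u t : ℂ))
    {R : ℝ} (hR : R ≤ 0) (hsu : tsupport u ⊆ Icc (-R) R) : u = 0 := by
  have hc : Continuous u := by
    have : u = fun t ↦ ((u t : ℂ)).re := funext fun t ↦ by simp
    rw [this]
    exact Complex.continuous_re.comp hu.1.continuous
  have h1 : Function.support u ⊆ interior (Icc (-R) R) :=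
    interior_maximal ((subset_tsupport u).trans hsu) hc.isOpen_support
  rw [interior_Icc, Set.Ioo_eq_empty_of_le (by linarith : R ≤ -R)] at h1
  exact Function.support_eq_empty_iff.mp (Set.subset_empty_iff.mp h1)

/-- **`CcDataContinuousOn R` holds for every `R`** (for `R ≤ 0` the window carries only the zero
function and the statement is trivial). -/
theorem ccDataContinuousOn_holds (R : ℝ) : CcDataContinuousOn R := by
  rcases lt_or_ge 0 R with hR | hR
  · exact ccDataContinuousOn_of_pos hR
  · intro u hu hsu δ hδ
    refine ⟨1, one_pos, fun v hv hsv _ _ ↦ ?_⟩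
    have hu0 := eq_zero_of_tsupport_subset_Icc_of_nonpos hu hR hsu
    have hv0 := eq_zero_of_tsupport_subset_Icc_of_nonpos hv hR hsv
    subst hu0 hv0
    simp [hδ.le]

/-- **`CcDataContinuous` holds**: the TEST-CLASS-DOWN node `∀ R > 0, CcDataContinuousOn R`. -/
theorem ccDataContinuous_holds : CcDataContinuous := fun R _ ↦ ccDataContinuousOn_holds R

/-- **THE FORCING LEMMA, PROVED**: on every arithmetic Weil surface the Castelnuovo–Severi
inequality decreed on the Frobenius lattice is forced on the whole real test class,
`2 𝔰(f,f) ≤ 2 (∫ f d*u)(∫ f du)` (span positivity from the Hodge-index field, homogeneity, the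
density axiom `gen.dense`, and `ccDataContinuous_holds`). -/
theorem weilPositivityForcing_holds : WeilPositivityForcing :=
  weilPositivityForcing_of_continuity ccDataContinuous_holds

/-- **THE SPRINT THEOREM, PROVED** (the named node `RiemannHypothesisOfArithmeticWeilSurface`):
`Nonempty ArithmeticWeilSurface → RiemannHypothesis`.  One-way; existence NOT claimed (located gap). -/
theorem riemannHypothesisOfArithmeticWeilSurface_holds : RiemannHypothesisOfArithmeticWeilSurface :=
  riemannHypothesisOfAWS_of_continuity ccDataContinuous_holds

/-- **`riemannHypothesis_of_arithmeticWeilSurface`**: an arithmetic Weil surface — an integral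
lattice with a symmetric real pairing, a hyperbolic pair `e₁, e₂` (`e₁² = e₂² = 0`, `e₁·e₂ = 1`),
Frobenius-graph-type classes whose pairings are the PRIME-SIDE explicit-formula data only
(`massDstar`, `massDu`, `2·ccPairing` of `Literature.NumberTheory.ConnesConsani2019`), the Hodge-index
sign condition on `⟨e₁, e₂⟩^⊥`, and the density (forcing) axiom on the generating family — implies
the Riemann Hypothesis (Mathlib's `RiemannHypothesis`).  One-way; existence NOT claimed. -/
theorem riemannHypothesis_of_arithmeticWeilSurface :
    Nonempty ArithmeticWeilSurface → _root_.RiemannHypothesis :=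
  riemannHypothesisOfArithmeticWeilSurface_holds

end Summit.RiemannHypothesis.RiemannHypothesis.Theorems.MotivicDoor.AWS
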